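import Summits.ValiantsHypothesis.ValiantsHypothesis.Theorems.SymPencilPerFourBlockPerm

/-!
# Route `SymPencil` — a `3 × 3` block with vanishing `2 × 2` subpermanents and block rows/columns
# of rank `≤ 2` has dimension `≤ 2`
# (primitive for Case C of Task T1 of `Cruxes/SdcSuperquadratic/NEXT-RUNG-23.md`;
# `--supports` stmt-ValiantsHypothesis-5674 `SdcSuperquadratic`)

`finrank_le_two_of_block_perm`: a subspace `U` of `4 × 4` matrices supported in the block
`{b, c, d} × {p, q, s}` (row `a` and column `j` vanish), on which all `2 × 2` subpermanents of the
block vanish and whose block rows and block columns all have rank `≤ 2`, has `dim U ≤ 2`.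
Proof: row filtration `U ⊇ U ∩ {row b = 0} ⊇ U ∩ {rows b, c = 0}` with pieces of dimensions
`n₁, n₂, n₃ ≤ 2`; polarising the subpermanents makes the pieces pairwise perm-orthogonal, so two
non-zero pieces are both lines (`SymPencilPerFourBlockPerm.exists_gen_of_perm_orth'`); hence
`dim U ≤ 2` unless the profile is `(1,1,1)`, where the three generators share a one-point support
(`common_support_of_perm_orth₃`) and that column has rank `3` on `U`.

Honest framing: linear algebra towards `sdc(per_4) ≥ 25`; nothing here changes
`sdc(per_4) ≥ 23`; the crux stays open; `VP ≠ VNP` is not moved. [folklore]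
-/

noncomputable section

-- single-conjunct layout: Sub = Summit, duplicated namespace component intended
set_option linter.dupNamespace false

namespace Summit.ValiantsHypothesis.ValiantsHypothesis.Theorems.SymPencilPerFourBlockPermRank

open Matrix Finset Module
open Literature.Computability.AlgebraicComplexity.AlperBogartVelasco
open Summit.ValiantsHypothesis.ValiantsHypothesis.Theorems.SymPencilPerFourTwoRowsPerm
open Summit.ValiantsHypothesis.ValiantsHypothesis.Theorems.SymPencilPerFourBlockPerm

variable {K : Type*} [Field K]

/-- A submodule all of whose elements are multiples of one vector has `finrank ≤ 1`. [folklore] -/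
theorem finrank_le_one_of_forall_smul {M : Type*} [AddCommGroup M] [Module K M]
    (P : Submodule K M) (v : M) (h : ∀ w ∈ P, ∃ t : K, w = t • v) : finrank K P ≤ 1 := by
  have hle : P ≤ K ∙ v := fun w hw => by
    obtain ⟨t, rfl⟩ := h w hw
    exact Submodule.smul_mem _ t (Submodule.mem_span_singleton_self v)
  have h2 : finrank K (K ∙ v) ≤ 1 := by
    by_cases hv : v = 0
    · rw [hv, Submodule.span_zero_singleton, finrank_bot]; exact zero_le_one
    · rw [finrank_span_singleton hv]
  exact (Submodule.finrank_mono hle).trans h2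

/-- **A block with vanishing `2 × 2` subpermanents and all block rows/columns of rank `≤ 2` has
`dim ≤ 2`.**  See the module docstring. [folklore] -/
theorem finrank_le_two_of_block_perm [CharZero K] (U : Submodule K (Fin 4 × Fin 4 → K))
    (a b c d : Fin 4) (hab : a ≠ b) (hac : a ≠ c) (had : a ≠ d) (hbc : b ≠ c) (hbd : b ≠ d)
    (hcd : c ≠ d) (p q s j : Fin 4) (hpq : p ≠ q) (hps : p ≠ s) (hqs : q ≠ s) (hjp : j ≠ p)
    (hjq : j ≠ q) (hjs : j ≠ s) (hcols : ∀ l : Fin 4, l = p ∨ l = q ∨ l = s ∨ l = j)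
    (hsuppa : ∀ x ∈ U, ∀ l, x (a, l) = 0) (hsuppj : ∀ x ∈ U, ∀ i, x (i, j) = 0)
    (hperm : ∀ x ∈ U, ∀ r r' : Fin 4, r ≠ a → r' ≠ a → r ≠ r' → ∀ l l' : Fin 4, l ≠ l' →
      x (r, l) * x (r', l') + x (r, l') * x (r', l) = 0)
    (hrow : ∀ r : Fin 4, finrank K (U.map (LinearMap.funLeft K K fun l : Fin 4 => (r, l))) ≤ 2)
    (hcol : ∀ l : Fin 4, finrank K (U.map (LinearMap.funLeft K K fun i : Fin 4 => (i, l))) ≤ 2) :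
    finrank K U ≤ 2 := by
  classical
  have hrows : ∀ i : Fin 4, i = a ∨ i = b ∨ i = c ∨ i = d := by
    have key : ∀ a b c d : Fin 4, a ≠ b → a ≠ c → a ≠ d → b ≠ c → b ≠ d → c ≠ d →
        ∀ i : Fin 4, i = a ∨ i = b ∨ i = c ∨ i = d := by decide
    exact key a b c d hab hac had hbc hbd hcd
  let ρ : Fin 4 → (Fin 4 × Fin 4 → K) →ₗ[K] (Fin 4 → K) :=
    fun r => LinearMap.funLeft K K fun l : Fin 4 => (r, l)
  have hρ : ∀ r x l, ρ r x l = x (r, l) := fun _ _ _ => rfl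
  have hrow' : ∀ r : Fin 4, finrank K (U.map (ρ r)) ≤ 2 := fun r => hrow r
  let γ : Fin 4 → (Fin 4 × Fin 4 → K) →ₗ[K] (Fin 4 → K) :=
    fun l => LinearMap.funLeft K K fun i : Fin 4 => (i, l)
  have hγ : ∀ l u i, γ l u i = u (i, l) := fun _ _ _ => rfl
  have hcol' : ∀ l : Fin 4, finrank K (U.map (γ l)) ≤ 2 := fun l => hcol l
  -- the filtration
  set U₀ : Submodule K (Fin 4 × Fin 4 → K) := U ⊓ LinearMap.ker (ρ b) with hU₀
  set U₀₀ : Submodule K (Fin 4 × Fin 4 → K) := U₀ ⊓ LinearMap.ker (ρ c) with hU₀₀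
  have memU₀ : ∀ x, x ∈ U₀ ↔ x ∈ U ∧ ∀ l, x (b, l) = 0 := fun x => by
    rw [hU₀, Submodule.mem_inf, LinearMap.mem_ker]
    exact ⟨fun h => ⟨h.1, fun l => by have := congr_fun h.2 l; rwa [hρ] at this⟩,
      fun h => ⟨h.1, funext fun l => h.2 l⟩⟩
  have memU₀₀ : ∀ x, x ∈ U₀₀ ↔ x ∈ U ∧ (∀ l, x (b, l) = 0) ∧ ∀ l, x (c, l) = 0 := fun x => by
    rw [hU₀₀, Submodule.mem_inf, LinearMap.mem_ker, memU₀]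
    exact ⟨fun h => ⟨h.1.1, h.1.2, fun l => by have := congr_fun h.2 l; rwa [hρ] at this⟩,
      fun h => ⟨⟨h.1, h.2.1⟩, funext fun l => h.2.2 l⟩⟩
  have hdim1 := finrank_eq_finrank_map_add_finrank_inf_ker U (ρ b)
  have hdim2 := finrank_eq_finrank_map_add_finrank_inf_ker U₀ (ρ c)
  rw [← hU₀] at hdim1
  rw [← hU₀₀] at hdim2
  -- bounds on the pieces from the row ranks
  have n1le : finrank K (U.map (ρ b)) ≤ 2 := hrow' b
  have n2le : finrank K (U₀.map (ρ c)) ≤ 2 :=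
    (Submodule.finrank_mono (Submodule.map_mono inf_le_left)).trans (hrow' c)
  have n3le : finrank K U₀₀ ≤ 2 := by
    -- `U₀₀ → row d` is injective
    have hker : LinearMap.ker ((ρ d).domRestrict U₀₀) = ⊥ := by
      rw [Submodule.eq_bot_iff]
      intro x hx
      rw [LinearMap.mem_ker, LinearMap.domRestrict_apply] at hx
      obtain ⟨hxU, hxb, hxc⟩ := (memU₀₀ x).1 x.2
      apply Subtype.ext
      funext ⟨i, l⟩
      change (x : Fin 4 × Fin 4 → K) (i, l) = 0
      rcases hrows i with hi | hi | hi | hi <;> rw [hi]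
      · exact hsuppa x hxU l
      · exact hxb l
      · exact hxc l
      · have := congr_fun hx l; rwa [hρ] at this
    have h1 := LinearMap.finrank_range_add_finrank_ker ((ρ d).domRestrict U₀₀)
    rw [hker, finrank_bot, add_zero, LinearMap.range_domRestrict] at h1
    have h2 : finrank K (U₀₀.map (ρ d)) ≤ finrank K (U.map (ρ d)) :=
      Submodule.finrank_mono (Submodule.map_mono (inf_le_left.trans inf_le_left))
    have := hrow' d
    omega
  -- polarised perm-orthogonality between the pieces
  have Pbc : ∀ z ∈ U, ∀ x ∈ U₀, ∀ l l' : Fin 4, l ≠ l' →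
      z (b, l) * x (c, l') + z (b, l') * x (c, l) = 0 := by
    intro z hz x hx l l' hll'
    obtain ⟨hxU, hxb⟩ := (memU₀ x).1 hx
    have h0 := hperm z hz b c hab.symm hac.symm hbc l l' hll'
    have h1 := hperm (z + x) (U.add_mem hz hxU) b c hab.symm hac.symm hbc l l' hll'
    simp only [Pi.add_apply, hxb, add_zero] at h1
    have h2 := hperm x hxU b c hab.symm hac.symm hbc l l' hll'
    simp only [hxb, zero_mul, add_zero] at h2
    linear_combination h1 - h0
  have Pbd : ∀ z ∈ U, ∀ y ∈ U₀₀, ∀ l l' : Fin 4, l ≠ l' →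
      z (b, l) * y (d, l') + z (b, l') * y (d, l) = 0 := by
    intro z hz y hy l l' hll'
    obtain ⟨hyU, hyb, -⟩ := (memU₀₀ y).1 hy
    have h0 := hperm z hz b d hab.symm had.symm hbd l l' hll'
    have h1 := hperm (z + y) (U.add_mem hz hyU) b d hab.symm had.symm hbd l l' hll'
    simp only [Pi.add_apply, hyb, add_zero] at h1
    linear_combination h1 - h0
  have Pcd : ∀ x ∈ U₀, ∀ y ∈ U₀₀, ∀ l l' : Fin 4, l ≠ l' →
      x (c, l) * y (d, l') + x (c, l') * y (d, l) = 0 := by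
    intro x hx y hy l l' hll'
    obtain ⟨hxU, -⟩ := (memU₀ x).1 hx
    obtain ⟨hyU, -, hyc⟩ := (memU₀₀ y).1 hy
    have h0 := hperm x hxU c d hac.symm had.symm hcd l l' hll'
    have h1 := hperm (x + y) (U.add_mem hxU hyU) c d hac.symm had.symm hcd l l' hll'
    simp only [Pi.add_apply, hyc, add_zero] at h1
    linear_combination h1 - h0
  -- key steps: a non-zero piece forces the other pieces to be lines
  have colj : ∀ x ∈ U, ∀ r, (ρ r x) j = 0 := fun x hx r => by rw [hρ]; exact hsuppj x hx r
  have key12 : (∃ x ∈ U₀, ρ c x ≠ 0) → finrank K (U.map (ρ b)) ≤ 1 := by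
    rintro ⟨x, hx, hξ⟩
    obtain ⟨v, hv⟩ := exists_gen_of_perm_orth' p q s j hpq hps hqs hjp hjq hjs hcols (ρ c x)
      (colj x ((memU₀ x).1 hx).1 c) hξ
    refine finrank_le_one_of_forall_smul _ v ?_
    rintro _ ⟨z, hz, rfl⟩
    exact hv (ρ b z) (colj z hz b) fun l l' hll' => by rw [hρ, hρ, hρ, hρ]; exact Pbc z hz x hx l l' hll'
  have key13 : (∃ y ∈ U₀₀, ρ d y ≠ 0) → finrank K (U.map (ρ b)) ≤ 1 := by
    rintro ⟨y, hy, hη⟩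
    obtain ⟨v, hv⟩ := exists_gen_of_perm_orth' p q s j hpq hps hqs hjp hjq hjs hcols (ρ d y)
      (colj y ((memU₀₀ y).1 hy).1 d) hη
    refine finrank_le_one_of_forall_smul _ v ?_
    rintro _ ⟨z, hz, rfl⟩
    exact hv (ρ b z) (colj z hz b) fun l l' hll' => by rw [hρ, hρ, hρ, hρ]; exact Pbd z hz y hy l l' hll'
  have key23 : (∃ y ∈ U₀₀, ρ d y ≠ 0) → finrank K (U₀.map (ρ c)) ≤ 1 := by
    rintro ⟨y, hy, hη⟩
    obtain ⟨v, hv⟩ := exists_gen_of_perm_orth' p q s j hpq hps hqs hjp hjq hjs hcols (ρ d y)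
      (colj y ((memU₀₀ y).1 hy).1 d) hη
    refine finrank_le_one_of_forall_smul _ v ?_
    rintro _ ⟨x, hx, rfl⟩
    exact hv (ρ c x) (colj x ((memU₀ x).1 hx).1 c) fun l l' hll' => by
      rw [hρ, hρ, hρ, hρ]; exact Pcd x hx y hy l l' hll'
  have key21 : (∃ z ∈ U, ρ b z ≠ 0) → finrank K (U₀.map (ρ c)) ≤ 1 := by
    rintro ⟨z, hz, hw⟩
    obtain ⟨v, hv⟩ := exists_gen_of_perm_orth' p q s j hpq hps hqs hjp hjq hjs hcols (ρ b z)
      (colj z hz b) hw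
    refine finrank_le_one_of_forall_smul _ v ?_
    rintro _ ⟨x, hx, rfl⟩
    exact hv (ρ c x) (colj x ((memU₀ x).1 hx).1 c) fun l l' hll' => by
      rw [hρ, hρ, hρ, hρ]
      have := Pbc z hz x hx l' l hll'.symm
      linear_combination this
  have key31 : (∃ z ∈ U, ρ b z ≠ 0) → finrank K U₀₀ ≤ 1 := by
    rintro ⟨z, hz, hw⟩
    obtain ⟨v, hv⟩ := exists_gen_of_perm_orth' p q s j hpq hps hqs hjp hjq hjs hcols (ρ b z)
      (colj z hz b) hw
    -- `U₀₀ → row d` injective, and the rows `d` are multiples of `v`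
    refine finrank_le_one_of_forall_smul U₀₀ (fun pr => if pr.1 = d then v pr.2 else 0) ?_
    intro y hy
    obtain ⟨hyU, hyb, hyc⟩ := (memU₀₀ y).1 hy
    obtain ⟨t, ht⟩ := hv (ρ d y) (colj y hyU d) fun l l' hll' => by
      rw [hρ, hρ, hρ, hρ]
      have := Pbd z hz y hy l' l hll'.symm
      linear_combination this
    refine ⟨t, funext fun ⟨i, l⟩ => ?_⟩
    simp only [Pi.smul_apply, smul_eq_mul]
    rcases hrows i with hi | hi | hi | hi <;> rw [hi]
    · rw [if_neg had]; simp [hsuppa y hyU l]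
    · rw [if_neg hbd]; simp [hyb l]
    · rw [if_neg hcd]; simp [hyc l]
    · rw [if_pos rfl]; have := congr_fun ht l; rw [hρ, Pi.smul_apply, smul_eq_mul] at this; exact this
  have key32 : (∃ x ∈ U₀, ρ c x ≠ 0) → finrank K U₀₀ ≤ 1 := by
    rintro ⟨x, hx, hξ⟩
    obtain ⟨v, hv⟩ := exists_gen_of_perm_orth' p q s j hpq hps hqs hjp hjq hjs hcols (ρ c x)
      (colj x ((memU₀ x).1 hx).1 c) hξ
    refine finrank_le_one_of_forall_smul U₀₀ (fun pr => if pr.1 = d then v pr.2 else 0) ?_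
    intro y hy
    obtain ⟨hyU, hyb, hyc⟩ := (memU₀₀ y).1 hy
    obtain ⟨t, ht⟩ := hv (ρ d y) (colj y hyU d) fun l l' hll' => by
      rw [hρ, hρ, hρ, hρ]
      have := Pcd x hx y hy l' l hll'.symm
      linear_combination this
    refine ⟨t, funext fun ⟨i, l⟩ => ?_⟩
    simp only [Pi.smul_apply, smul_eq_mul]
    rcases hrows i with hi | hi | hi | hi <;> rw [hi]
    · rw [if_neg had]; simp [hsuppa y hyU l]
    · rw [if_neg hbd]; simp [hyb l]
    · rw [if_neg hcd]; simp [hyc l]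
    · rw [if_pos rfl]; have := congr_fun ht l; rw [hρ, Pi.smul_apply, smul_eq_mul] at this; exact this
  -- non-zero pieces
  have nz1 : 0 < finrank K (U.map (ρ b)) → ∃ z ∈ U, ρ b z ≠ 0 := fun h => by
    obtain ⟨⟨w, hw⟩, hw0⟩ := (Module.finrank_pos_iff_exists_ne_zero).1 h
    obtain ⟨z, hz, rfl⟩ := hw
    exact ⟨z, hz, fun h0 => hw0 (Subtype.ext h0)⟩
  have nz2 : 0 < finrank K (U₀.map (ρ c)) → ∃ x ∈ U₀, ρ c x ≠ 0 := fun h => by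
    obtain ⟨⟨w, hw⟩, hw0⟩ := (Module.finrank_pos_iff_exists_ne_zero).1 h
    obtain ⟨x, hx, rfl⟩ := hw
    exact ⟨x, hx, fun h0 => hw0 (Subtype.ext h0)⟩
  have nz3 : 0 < finrank K U₀₀ → ∃ y ∈ U₀₀, ρ d y ≠ 0 := fun h => by
    obtain ⟨⟨y, hy⟩, hy0⟩ := (Module.finrank_pos_iff_exists_ne_zero).1 h
    refine ⟨y, hy, fun h0 => hy0 (Subtype.ext ?_)⟩
    obtain ⟨hyU, hyb, hyc⟩ := (memU₀₀ y).1 hy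
    funext ⟨i, l⟩
    change y (i, l) = 0
    rcases hrows i with hi | hi | hi | hi <;> rw [hi]
    · exact hsuppa y hyU l
    · exact hyb l
    · exact hyc l
    · have := congr_fun h0 l; rwa [hρ] at this
  -- the count: unless the profile is `(1,1,1)`, `dim U ≤ 2`
  by_contra hgt
  push Not at hgt
  have h111 : finrank K (U.map (ρ b)) = 1 ∧ finrank K (U₀.map (ρ c)) = 1 ∧ finrank K U₀₀ = 1 := by
    by_cases p1 : 0 < finrank K (U.map (ρ b)) <;> by_cases p2 : 0 < finrank K (U₀.map (ρ c)) <;>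
      by_cases p3 : 0 < finrank K U₀₀
    · have := key12 (nz2 p2); have := key21 (nz1 p1); have := key31 (nz1 p1); omega
    · have := key12 (nz2 p2); have := key21 (nz1 p1); omega
    · have := key13 (nz3 p3); have := key31 (nz1 p1); omega
    · omega
    · have := key23 (nz3 p3); have := key32 (nz2 p2); omega
    · omega
    · omega
    · omega
  obtain ⟨h1, h2, h3⟩ := h111
  -- the profile `(1,1,1)`: common support column of rank `3`
  obtain ⟨z, hz, hw⟩ := nz1 (by omega)
  obtain ⟨x, hx, hξ⟩ := nz2 (by omega)
  obtain ⟨y, hy, hη⟩ := nz3 (by omega)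
  have hxU := ((memU₀ x).1 hx).1
  have hxb := ((memU₀ x).1 hx).2
  obtain ⟨hyU, hyb, hyc⟩ := (memU₀₀ y).1 hy
  obtain ⟨l₀, hl₀j, hl₀⟩ := common_support_of_perm_orth₃ p q s j hpq hps hqs hjp hjq hjs hcols
    (ρ b z) (ρ c x) (ρ d y) (colj z hz b) (colj x hxU c) (colj y hyU d) hw hξ hη
    (fun l l' hll' => by rw [hρ, hρ, hρ, hρ]; exact Pbc z hz x hx l l' hll')
    (fun l l' hll' => by rw [hρ, hρ, hρ, hρ]; exact Pbd z hz y hy l l' hll')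
    (fun l l' hll' => by rw [hρ, hρ, hρ, hρ]; exact Pcd x hx y hy l l' hll')
  simp only [hρ] at hl₀
  -- the generators have non-zero `l₀`-coordinate
  have hwl : z (b, l₀) ≠ 0 := fun h0 => hw (funext fun l => by
    rw [hρ]; by_cases hl : l = l₀
    · rw [hl]; exact h0
    · exact (hl₀ l hl).1)
  have hξl : x (c, l₀) ≠ 0 := fun h0 => hξ (funext fun l => by
    rw [hρ]; by_cases hl : l = l₀
    · rw [hl]; exact h0
    · exact (hl₀ l hl).2.1)
  have hηl : y (d, l₀) ≠ 0 := fun h0 => hη (funext fun l => by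
    rw [hρ]; by_cases hl : l = l₀
    · rw [hl]; exact h0
    · exact (hl₀ l hl).2.2)
  -- every row `b` of `U` is a multiple of `ρ b z`, etc.
  have hspan1 : ∀ u ∈ U, ∃ t : K, ρ b u = t • ρ b z := by
    intro u hu
    have hmem : ρ b u ∈ U.map (ρ b) := ⟨u, hu, rfl⟩
    have hzmem : ρ b z ∈ U.map (ρ b) := ⟨z, hz, rfl⟩
    have := (finrank_eq_one_iff_of_nonzero' (⟨ρ b z, hzmem⟩ : U.map (ρ b))
      (fun h => hw (Subtype.ext_iff.1 h))).1 h1 ⟨ρ b u, hmem⟩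
    obtain ⟨t, ht⟩ := this
    exact ⟨t, by have := Subtype.ext_iff.1 ht; simpa using this.symm⟩
  have hspan2 : ∀ u ∈ U₀, ∃ t : K, ρ c u = t • ρ c x := by
    intro u hu
    have hmem : ρ c u ∈ U₀.map (ρ c) := ⟨u, hu, rfl⟩
    have hxmem : ρ c x ∈ U₀.map (ρ c) := ⟨x, hx, rfl⟩
    have := (finrank_eq_one_iff_of_nonzero' (⟨ρ c x, hxmem⟩ : U₀.map (ρ c))
      (fun h => hξ (Subtype.ext_iff.1 h))).1 h2 ⟨ρ c u, hmem⟩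
    obtain ⟨t, ht⟩ := this
    exact ⟨t, by have := Subtype.ext_iff.1 ht; simpa using this.symm⟩
  have hspan3 : ∀ u ∈ U₀₀, ∃ t : K, u = t • y := by
    intro u hu
    have := (finrank_eq_one_iff_of_nonzero' (⟨y, hy⟩ : U₀₀)
      (fun h => hη (by rw [show y = 0 from Subtype.ext_iff.1 h, map_zero]))).1 h3 ⟨u, hu⟩
    obtain ⟨t, ht⟩ := this
    exact ⟨t, by have := Subtype.ext_iff.1 ht; simpa using this.symm⟩
  -- the column `l₀` map is injective on `U`
  have hinj : LinearMap.ker ((γ l₀).domRestrict U) = ⊥ := by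
    rw [Submodule.eq_bot_iff]
    intro u hu
    rw [LinearMap.mem_ker, LinearMap.domRestrict_apply] at hu
    have hu0 : ∀ i, (u : Fin 4 × Fin 4 → K) (i, l₀) = 0 := fun i => by
      have := congr_fun hu i; rwa [hγ] at this
    -- row `b` of `u` vanishes
    obtain ⟨t₁, ht₁⟩ := hspan1 u u.2
    have hub : ∀ l, (u : Fin 4 × Fin 4 → K) (b, l) = 0 := by
      have htl : t₁ * z (b, l₀) = 0 := by
        have := congr_fun ht₁ l₀
        rw [hρ, hu0 b, Pi.smul_apply, hρ, smul_eq_mul] at this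
        exact this.symm
      have ht0 : t₁ = 0 := (mul_eq_zero.1 htl).resolve_right hwl
      intro l
      have := congr_fun ht₁ l
      rw [hρ, Pi.smul_apply, hρ, ht0, zero_smul] at this
      exact this
    have huU₀ : (u : Fin 4 × Fin 4 → K) ∈ U₀ := (memU₀ _).2 ⟨u.2, hub⟩
    obtain ⟨t₂, ht₂⟩ := hspan2 u huU₀
    have huc : ∀ l, (u : Fin 4 × Fin 4 → K) (c, l) = 0 := by
      have htl : t₂ * x (c, l₀) = 0 := by
        have := congr_fun ht₂ l₀
        rw [hρ, hu0 c, Pi.smul_apply, hρ, smul_eq_mul] at this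
        exact this.symm
      have ht0 : t₂ = 0 := (mul_eq_zero.1 htl).resolve_right hξl
      intro l
      have := congr_fun ht₂ l
      rw [hρ, Pi.smul_apply, hρ, ht0, zero_smul] at this
      exact this
    have huU₀₀ : (u : Fin 4 × Fin 4 → K) ∈ U₀₀ := (memU₀₀ _).2 ⟨u.2, hub, huc⟩
    obtain ⟨t₃, ht₃⟩ := hspan3 u huU₀₀
    have ht0 : t₃ = 0 := by
      have := congr_fun ht₃ (d, l₀)
      rw [hu0 d, Pi.smul_apply, smul_eq_mul] at this
      exact (mul_eq_zero.1 this.symm).resolve_right hηl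
    apply Subtype.ext
    rw [ht₃, ht0, zero_smul]
    rfl
  have hrank : finrank K (U.map (γ l₀)) = finrank K U := by
    have h := LinearMap.finrank_range_add_finrank_ker ((γ l₀).domRestrict U)
    rw [hinj, finrank_bot, add_zero, LinearMap.range_domRestrict] at h
    exact h
  have := hcol' l₀
  omega

end Summit.ValiantsHypothesis.ValiantsHypothesis.Theorems.SymPencilPerFourBlockPermRank

end
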